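import Summits.QuantumFields.BalabanUV.T4Continuum.Support.RegionGaugeSliceOrth
import Summits.QuantumFields.BalabanUV.T4Continuum.Support.RegionGaugeFixedVector
import Summits.QuantumFields.BalabanUV.T4Continuum.Support.LineAveragingPairingLaw

/-!
# `BalabanUV.T4Continuum.Support.RegionGaugeSliceOrthRegion` — NE2 (node U1a) formalisation swarm, SUPPLIER item «Δ1-COERC-ORTH» under
# the owner's sub-row `T4-U1a.S-NE2-D1-DIRICHLET°` (vector layer, W1): THE INSTANCE — for leaf-07-g5's [B9]-faithful `U = 1` region vector
# operator `regionDeltaA n M a a′ S` on the star bonds of `Ω = blockReg n M S`, the displayed slice inequality `SliceCoercive` (memo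
# `t4/T4-EST-NE2-D1-COERC.md` §6) FOLLOWS from coercivity of `‖curl A‖² + a n^d‖QA‖²` on the fields with BLOCK-CONSTANT region divergence,
# with the explicit, region-independent factor `1 + 4d/σ₀(d,a′)` (unit b2b-balaban-t4-ne2-formalise-leaf-09, gen 8, v1)

HONEST FRAMING (T4-DAG p. 1).  [folklore] `U = 1` lattice bookkeeping, ONE region (any decidable set `S` of unit blocks), ONE averaging scale,
finite torus; a REDUCTION — the orthogonal-slice inequality `OrthSliceCoercive (curlR n M S) (gradR n M S) (QOm n M S) (avgR n M S) (a·n^d) c`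
is DISPLAYED, not proved, for `S ≠ ⊤`; nothing printed is a hypothesis; NE2 (U1a) NOT proved; spine PROVED 0/9 unchanged; NOT [B9] (3.23)–(3.27)
as printed; NOT infinite volume, NOT the mass gap, NOT Clay.  HONEST DEPENDENCY (verbatim): «continuum YM on T⁴ ⇐ BetaPertH ∧ nine spine
estimates (0/9 proved); BetaPertH ⇐ (D1) ∧ (D4) ∧ CAP+tail; G-an2-4 gates asym, D1 and NE2/3/4.»

WHAT THIS FILE PROVES (0 sorry; leaf-07-g5's `RegionGaugeFixedVector`/`RegionScalarCompression`, leaf-09's `RegionGaugeSliceOrth`, the tree's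
block Poincaré inequality `ScalarBlockPoincare.nsq_sub_PiS_le` and `LineAveragingPairingLaw.QsOp_mul_conjTranspose` BY NAME):
 * §1 the four quantitative inputs of `RegionGaugeSliceOrth.sliceCoercive_of_orthSlice` for the region data, all UNIFORM in `n = η⁻¹`, `M`, `S`:
   **`QOm_mul_conjTranspose`** `Q′_ΩQ′_Ωᴴ = n^{−d}·1` (θ = n^{−d}); **`nsq_gradR_mulVec`** `nsq (∂_Ωμ) = Σ_ν nsq (∂_ν ext μ)`
   (the pointwise form `gradR_mulVec` is leaf-07-g6's `RegionGaugeFixedVectorTop.gradR_mulVec`; here only the norm identity is needed);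
   **`blockPoincare_region`** `Q′_Ωμ = 0 ⟹ nsq μ ≤ 4d·nsq (∂_Ωμ)` (`C_P = 4d`); **`coercive_GOm_const`** `σ₀·nsq (Q′_Ωᴴφ) ≤ re⟨Q′_Ωᴴφ, G′_ΩQ′_Ωᴴφ⟩`
   (`κ = σ₀(d,a′)`, from `form_ScompR_ge`); **`nsq_gradR_le_form_DOm`** `nsq (∂_Ωφ) ≤ re⟨φ, D^Ωφ⟩` (`D^Ω = (Δ + a′Π′)_{ΩΩ} ≥ ∂_Ωᴴ∂_Ω`).
 * §2 THE ENDS: **`sliceCoercive_region_of_orthSlice (ha′) (hc : 0 ≤ c) : OrthSliceCoercive (curlR …) (gradR …) (QOm …) (avgR …) (a·n^d) c →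
   SliceCoercive (curlR …) (gradR …) (GOm n M a′ S) (QOm …) (avgR …) (a·n^d) (c / (1 + 4d/σ₀ d a′))`**, the converse
   `orthSlice_region_of_sliceCoercive` (same `c`) and `orthSlice_region_of_coercive` (every coercivity constant of `Δ_a(Ω₀)` is an
   orthogonal-slice constant); **`opNorm_inv_regionDeltaA_le_of_orthSlice`**: `‖(Δ_a(Ω₀))⁻¹‖ ≤ (min (c/(1 + 4d/σ₀)/2) (1/(2γ′⁻¹)))⁻¹`;
   and the CONCRETE FORM of what stays displayed, **`orthSlice_region_iff`**: `OrthSliceCoercive … c` ⟺ «every `A` on the star bonds whose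
   region divergence is block-constant, `∂_ΩᴴA = Q′_Ωᴴcc`, obeys `c·nsq A ≤ nsq (curlR A) + a n^d·nsq (avgR A)`» — no Green's function,
   no projection `R(Ω₀)` left in the hypothesis.

ABSOLUTE RULE (cell, verbatim): «No internally-minted statement may enter as a cited fact. Every hypothesis is either kernel-proved in
this package or a verbatim quotation of a PUBLISHED theorem with page reference. The manuscript(s) under audit are NOT citable for
their own disputed steps — they are the thing under adjudication; programme-internal (2001/route/tribunal) claims are never citable.»
[folklore] throughout; parametrised shape predicates only (`OrthSliceCoercive`, `SliceCoercive`, `Coercive`); no `def … : Prop` fact.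
NOT CLAIMED: the orthogonal-slice inequality for any `S ≠ ⊤`; any gradient-form bound; NE2; NE3; «not in print; our reduction».
-/

noncomputable section

open scoped BigOperators ComplexConjugate Matrix Matrix.Norms.L2Operator

namespace Summit.QuantumFields.BalabanUV.T4Continuum.RegionGaugeSliceOrthRegion

open Literature.MathematicalPhysics.QuantumFieldTheory.Balaban1983to89.B5Prop11Plancherel (Tor fine unitVec)
open Literature.MathematicalPhysics.QuantumFieldTheory.Balaban1983to89.B5Prop11Lower (nsq nsq_nonneg star_dotProduct_self)
open Literature.MathematicalPhysics.QuantumFieldTheory.Balaban1983to89.B5Action121 (sdiff LapS GradOp star_mulVec_dotProduct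
  dotProduct_mulVec_eq_star_conjTranspose_mulVec)
open Literature.MathematicalPhysics.QuantumFieldTheory.Balaban1983to89.B5Block118 (QsOp)
open Literature.MathematicalPhysics.QuantumFieldTheory.Balaban1983to89.B5Blocks16 (blockOf)
open Summit.QuantumFields.BalabanUV.T4Continuum
open Summit.QuantumFields.BalabanUV.T4Continuum.SubtypeCompression (Coercive ext ext_apply_of ext_apply_of_not nsq_ext form_toBlock
  toBlock_smul toBlock_one toBlock_conjTranspose toBlock_mul_of_vanish_left)
open Summit.QuantumFields.BalabanUV.T4Continuum.ScalarBlockPoincare (PiS nsq_sub_PiS_le nsq_PiS_mulVec_eq)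
open Summit.QuantumFields.BalabanUV.T4Continuum.ScalarAveragedPropagator (DeltaPs gammaPs gammaPs_pos dirichlet re_form_DeltaPs
  nsq_GradOp_mulVec)
open Summit.QuantumFields.BalabanUV.T4Continuum.ScalarAveragedCompression (sigma0 sigma0_pos)
open Summit.QuantumFields.BalabanUV.T4Continuum.LineAveragingPairing (QsOp_mul_conjTranspose)
open Summit.QuantumFields.BalabanUV.T4Continuum.RegionGaugeProjection (nsq_QH_mulVec)
open Summit.QuantumFields.BalabanUV.T4Continuum.RegionGaugeSlice (SliceCoercive sliceCoercive_of_coercive coercive_gaugeFixed_of_slice)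
open Summit.QuantumFields.BalabanUV.T4Continuum.RegionGaugeSliceOrth (OrthSliceCoercive sliceCoercive_of_orthSlice
  orthSlice_of_sliceCoercive orthSlice_iff_div_const)
open Summit.QuantumFields.BalabanUV.T4Continuum.RegionScalarCompression (QOm GOm ScompR GOm_isHermitian form_ScompR form_ScompR_ge)
open Summit.QuantumFields.BalabanUV.T4Continuum.RegionGaugeFixedVector (starReg curlR gradR avgR grad₁R regionDeltaA sliceData_region
  QsOp_apply_eq_zero GradOp_apply_eq_zero_of_not_star sum_star_eq isUnit_det_regionDeltaA_of_slice opNorm_inv_regionDeltaA_le_of_slice)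
open Summit.QuantumFields.BalabanUV.Beta.GAN24.DirichletBoxCompression (DOm opNorm_inv_DOm_le toBlock_mulVec')
open Summit.QuantumFields.BalabanUV.Beta.GAN24.DirichletBoxTrace (blockReg)

variable {d : ℕ} (n : ℕ) [NeZero n] (M : Fin d → ℕ) [hM : ∀ μ, NeZero (M μ)] (a a' : ℝ) (S : Tor M → Prop) [DecidablePred S]

/-! ## §1 The four quantitative inputs for the region data -/

/-- **`Q′_Ω·Q′_Ωᴴ = n^{−d}·1`**: the region rows of the block averaging are orthogonal with squared norm `n^{−d}` (every block of `S` lies in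
`Ω` entirely; `Q′` never couples a block to a site outside it). [folklore] -/
theorem QOm_mul_conjTranspose :
    QOm n M S * (QOm n M S)ᴴ = ((((n : ℝ) ^ d)⁻¹ : ℝ) : ℂ) • (1 : Matrix {y // S y} {y // S y} ℂ) := by
  have hcast : ((((n : ℝ) ^ d)⁻¹ : ℝ) : ℂ) = ((n : ℂ) ^ d)⁻¹ := by push_cast; ring
  have hX : ∀ (y : Tor M) (x : Tor (fine n M)), S y → ¬ blockReg n M S x → QsOp n M y x = 0 := fun y x hy hx =>
    QsOp_apply_eq_zero n M (fun h => hx (show S (blockOf n M x) by rw [h]; exact hy))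
  unfold QOm
  rw [toBlock_conjTranspose, ← toBlock_mul_of_vanish_left S (blockReg n M S) S (QsOp n M) (QsOp n M)ᴴ hX, QsOp_mul_conjTranspose, toBlock_smul,
    toBlock_one, hcast]

/-- off the star bonds the gradient of a field supported in `Ω` vanishes. [folklore] -/
theorem GradOp_ext_apply_of_not_star (mu : {x // blockReg n M S x} → ℂ) {b : Tor (fine n M) × Fin d} (hb : ¬ starReg n M S b) :
    (GradOp (fine n M) (n : ℂ) *ᵥ ext (blockReg n M S) mu) b = 0 := by
  simp only [Matrix.mulVec, dotProduct]
  refine Finset.sum_eq_zero fun y _ => ?_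
  by_cases hy : blockReg n M S y
  · rw [GradOp_apply_eq_zero_of_not_star n M S hb hy, zero_mul]
  · rw [ext_apply_of_not _ _ hy, mul_zero]

/-- **`nsq (∂_Ωμ) = Σ_ν nsq (∂_ν ext μ)`**: the star bonds carry the whole Dirichlet form of a scalar supported in `Ω`. [folklore] -/
theorem nsq_gradR_mulVec (mu : {x // blockReg n M S x} → ℂ) :
    nsq (gradR n M S *ᵥ mu) = dirichlet n M (ext (blockReg n M S) mu) := by
  unfold gradR
  rw [← nsq_GradOp_mulVec, toBlock_mulVec']
  unfold nsq
  have h := sum_star_eq n M S (f := fun b => (((‖(GradOp (fine n M) (n : ℂ) *ᵥ ext (blockReg n M S) mu) b‖ ^ 2 : ℝ) : ℂ)))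
    fun b hb => by rw [GradOp_ext_apply_of_not_star n M S mu hb, norm_zero, zero_pow two_ne_zero, Complex.ofReal_zero]
  exact_mod_cast h

/-- a scalar on `Ω` with vanishing region block averages has vanishing TORUS block averages after extension by zero. [folklore] -/
theorem QsOp_ext_eq_zero (mu : {x // blockReg n M S x} → ℂ) (h : QOm n M S *ᵥ mu = 0) :
    QsOp n M *ᵥ ext (blockReg n M S) mu = 0 := by
  funext y
  by_cases hy : S y
  · have e := congrFun h ⟨y, hy⟩
    rw [Pi.zero_apply] at e
    unfold QOm at e
    rw [toBlock_mulVec'] at e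
    exact e
  · rw [Pi.zero_apply]
    simp only [Matrix.mulVec, dotProduct]
    refine Finset.sum_eq_zero fun x _ => ?_
    by_cases hx : blockReg n M S x
    · rw [QsOp_apply_eq_zero n M (fun h' => hy (by rw [← h']; exact hx)), zero_mul]
    · rw [ext_apply_of_not _ _ hx, mul_zero]

/-- **THE BLOCK POINCARÉ INEQUALITY ON `N(Q′_Ω)`**: `Q′_Ωμ = 0 ⟹ nsq μ ≤ 4d·nsq (∂_Ωμ)` — `C_P = 4d`, uniform in `n`, `M`, `S`
(the tree's `nsq_sub_PiS_le` for the zero-extension, whose block means all vanish). [folklore] -/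
theorem blockPoincare_region (mu : {x // blockReg n M S x} → ℂ) (h : QOm n M S *ᵥ mu = 0) :
    nsq mu ≤ 4 * d * nsq (gradR n M S *ᵥ mu) := by
  have hPi : PiS n M *ᵥ ext (blockReg n M S) mu = 0 := by
    rw [PiS, Matrix.smul_mulVec, ← Matrix.mulVec_mulVec, QsOp_ext_eq_zero n M S mu h, Matrix.mulVec_zero, smul_zero]
  have h1 := nsq_sub_PiS_le n M (ext (blockReg n M S) mu)
  rw [hPi, sub_zero, nsq_ext] at h1
  rw [nsq_gradR_mulVec]
  exact h1

/-- **`G′_Ω` IS `σ₀`-COERCIVE ON BLOCK CONSTANTS**: `σ₀·nsq (Q′_Ωᴴφ) ≤ re⟨Q′_Ωᴴφ, G′_ΩQ′_Ωᴴφ⟩`, `σ₀ = (36^d(4d + a′))⁻¹` — leaf-07-g5's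
region (3.48)-shape bound `S_Ω = n^d·Q′_ΩG′_ΩQ′_Ωᴴ ≥ σ₀` re-read with `nsq (Q′_Ωᴴφ) = n^{−d}·nsq φ`.
[cite: Balaban1985BackgroundPropagators, p.395 (positivity of G′) (shape)] [folklore] -/
theorem coercive_GOm_const (ha' : 0 < a') (φ : {y // S y} → ℂ) :
    sigma0 d a' * nsq ((QOm n M S)ᴴ *ᵥ φ) ≤ (star ((QOm n M S)ᴴ *ᵥ φ) ⬝ᵥ (GOm n M a' S *ᵥ ((QOm n M S)ᴴ *ᵥ φ))).re := by
  have hn : (0 : ℝ) < (n : ℝ) ^ d := pow_pos (by exact_mod_cast Nat.pos_of_ne_zero (NeZero.ne n)) d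
  set Z := star ((QOm n M S)ᴴ *ᵥ φ) ⬝ᵥ (GOm n M a' S *ᵥ ((QOm n M S)ᴴ *ᵥ φ)) with hZ
  have h1 := form_ScompR_ge n M a' S ha' φ
  have e : (star φ ⬝ᵥ (ScompR n M a' S *ᵥ φ)).re = (n : ℝ) ^ d * Z.re := by
    rw [form_ScompR, ← hZ]
    have hc : ((n : ℂ) ^ d) = (((n : ℝ) ^ d : ℝ) : ℂ) := by push_cast; ring
    rw [hc, Complex.re_ofReal_mul]
  rw [e] at h1
  rw [nsq_QH_mulVec (QOm n M S) (QOm_mul_conjTranspose n M S) φ]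
  have e2 : sigma0 d a' * (((n : ℝ) ^ d)⁻¹ * nsq φ) = ((n : ℝ) ^ d)⁻¹ * (sigma0 d a' * nsq φ) := by ring
  rw [e2, inv_mul_le_iff₀ hn]
  exact h1

/-- **`∂_Ωᴴ∂_Ω ≤ D^Ω` AS FORMS**: `nsq (∂_Ωφ) ≤ re⟨φ, D^Ωφ⟩` (`D^Ω = (Δ + a′Π′)_{ΩΩ}`, `0 ≤ a′`). [folklore] -/
theorem nsq_gradR_le_form_DOm (ha' : 0 ≤ a') (φ : {x // blockReg n M S x} → ℂ) :
    nsq (gradR n M S *ᵥ φ) ≤ (star φ ⬝ᵥ (DOm n M a' (blockReg n M S) *ᵥ φ)).re := by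
  unfold DOm
  rw [form_toBlock, re_form_DeltaPs, nsq_gradR_mulVec]
  have := nsq_nonneg (PiS n M *ᵥ ext (blockReg n M S) φ)
  nlinarith

/-! ## §2 The ENDs for the region -/

/-- **THE DISPLAYED SLICE INEQUALITY FOLLOWS FROM THE ORTHOGONAL-SLICE INEQUALITY**, with the region-independent factor `1 + 4d/σ₀`:
`OrthSliceCoercive … c ⟹ SliceCoercive … (c/(1 + 4d/σ₀(d,a′)))` for leaf-07-g5's region data, every decidable `S`, every `n`, `M`.
[cite: Balaban1985BackgroundPropagators, (3.25)–(3.27) pp.394–395 (shapes)] [folklore] -/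
theorem sliceCoercive_region_of_orthSlice (ha' : 0 < a') {c : ℝ} (hc : 0 ≤ c)
    (hO : OrthSliceCoercive (curlR n M S) (gradR n M S) (QOm n M S) (avgR n M S) (a * (n : ℝ) ^ d) c) :
    SliceCoercive (curlR n M S) (gradR n M S) (GOm n M a' S) (QOm n M S) (avgR n M S) (a * (n : ℝ) ^ d)
      (c / (1 + 4 * d / sigma0 d a')) :=
  sliceCoercive_of_orthSlice (sliceData_region n M a' S ha') (QOm_mul_conjTranspose n M S)
    (inv_pos.mpr (pow_pos (by exact_mod_cast Nat.pos_of_ne_zero (NeZero.ne n)) d)) (by positivity) (sigma0_pos ha') hc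
    (blockPoincare_region n M S) (coercive_GOm_const n M a' S ha') (nsq_gradR_le_form_DOm n M a' S ha'.le) hO

/-- conversely the displayed slice inequality (with `c ≥ 0`) gives the orthogonal-slice inequality with the SAME constant. [folklore] -/
theorem orthSlice_region_of_sliceCoercive (ha' : 0 < a') {c : ℝ} (hc : 0 ≤ c)
    (hS : SliceCoercive (curlR n M S) (gradR n M S) (GOm n M a' S) (QOm n M S) (avgR n M S) (a * (n : ℝ) ^ d) c) :
    OrthSliceCoercive (curlR n M S) (gradR n M S) (QOm n M S) (avgR n M S) (a * (n : ℝ) ^ d) c :=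
  orthSlice_of_sliceCoercive (sliceData_region n M a' S ha') hc hS

/-- and every coercivity constant `γ ≥ 0` of `Δ_a(Ω₀)` is an orthogonal-slice constant. [folklore] -/
theorem orthSlice_region_of_coercive (ha' : 0 < a') {γ : ℝ} (hγ : 0 ≤ γ) (h : Coercive (regionDeltaA n M a a' S) γ) :
    OrthSliceCoercive (curlR n M S) (gradR n M S) (QOm n M S) (avgR n M S) (a * (n : ℝ) ^ d) γ :=
  orthSlice_region_of_sliceCoercive n M a a' S ha' hγ
    (sliceCoercive_of_coercive _ (GOm_isHermitian n M a' S)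
      (RegionScalarCompression.isUnit_det_gramK_region n M a' S ha') h)

/-- **«G(Ω₀) EXISTS WITH A BOUND» FROM THE ORTHOGONAL-SLICE INEQUALITY**: `‖(Δ_a(Ω₀))⁻¹‖ ≤ (min (c′/2) (1/(2γ′⁻¹)))⁻¹`,
`c′ = c/(1 + 4d/σ₀)`, `γ′ = gammaPs d a′` — uniform in whatever `c` is uniform in.
[cite: Balaban1985BackgroundPropagators, (3.27) p.395 (shape)] [folklore] -/
theorem opNorm_inv_regionDeltaA_le_of_orthSlice (ha' : 0 < a') {c : ℝ} (hc : 0 < c)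
    (hO : OrthSliceCoercive (curlR n M S) (gradR n M S) (QOm n M S) (avgR n M S) (a * (n : ℝ) ^ d) c) :
    ‖(regionDeltaA n M a a' S)⁻¹‖ ≤ (min (c / (1 + 4 * d / sigma0 d a') / 2) (1 / (2 * (gammaPs d a')⁻¹)))⁻¹ :=
  opNorm_inv_regionDeltaA_le_of_slice n M a a' S ha' (div_pos hc (by have := sigma0_pos (d := d) ha'; positivity))
    (sliceCoercive_region_of_orthSlice n M a a' S ha' hc.le hO)

/-- the same as a COERCIVITY constant of `Δ_a(Ω₀)` (the owner's W1 socket `Coercive (D k) γ`). [folklore] -/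
theorem coercive_regionDeltaA_of_orthSlice (ha' : 0 < a') {c : ℝ} (hc : 0 < c)
    (hO : OrthSliceCoercive (curlR n M S) (gradR n M S) (QOm n M S) (avgR n M S) (a * (n : ℝ) ^ d) c) :
    Coercive (regionDeltaA n M a a' S) (min (c / (1 + 4 * d / sigma0 d a') / 2) (1 / (2 * (gammaPs d a')⁻¹))) :=
  coercive_gaugeFixed_of_slice _ (sliceData_region n M a' S ha') (div_pos hc (by have := sigma0_pos (d := d) ha'; positivity))
    (sliceCoercive_region_of_orthSlice n M a a' S ha' hc.le hO) (opNorm_inv_DOm_le n M a' (blockReg n M S) ha')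
    (inv_pos.mpr (gammaPs_pos (d := d) (a' := a')).1)

/-- and invertibility. [folklore] -/
theorem isUnit_det_regionDeltaA_of_orthSlice (ha' : 0 < a') {c : ℝ} (hc : 0 < c)
    (hO : OrthSliceCoercive (curlR n M S) (gradR n M S) (QOm n M S) (avgR n M S) (a * (n : ℝ) ^ d) c) :
    IsUnit (regionDeltaA n M a a' S).det :=
  isUnit_det_regionDeltaA_of_slice n M a a' S ha' (div_pos hc (by have := sigma0_pos (d := d) ha'; positivity))
    (sliceCoercive_region_of_orthSlice n M a a' S ha' hc.le hO)

/-- **THE CONCRETE FORM OF WHAT STAYS DISPLAYED**: the orthogonal-slice inequality for the region is EXACTLY «every field on the star bonds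
whose region divergence is block-constant (`∂_ΩᴴA = Q′_Ωᴴcc`) obeys `c·nsq A ≤ nsq (curlR A) + a n^d·nsq (avgR A)`». [folklore] -/
theorem orthSlice_region_iff (c : ℝ) :
    OrthSliceCoercive (curlR n M S) (gradR n M S) (QOm n M S) (avgR n M S) (a * (n : ℝ) ^ d) c
      ↔ ∀ (A : {b // starReg n M S b} → ℂ) (cc : {y // S y} → ℂ), (gradR n M S)ᴴ *ᵥ A = (QOm n M S)ᴴ *ᵥ cc →
          c * nsq A ≤ nsq (curlR n M S *ᵥ A) + a * (n : ℝ) ^ d * nsq (avgR n M S *ᵥ A) :=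
  orthSlice_iff_div_const (QOm_mul_conjTranspose n M S)
    (inv_ne_zero (pow_ne_zero d (by exact_mod_cast NeZero.ne n))) _ c

end Summit.QuantumFields.BalabanUV.T4Continuum.RegionGaugeSliceOrthRegion

end
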